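/-
Copyright (c) 2026 The HodgeConjecture formalisation campaign. All rights reserved.
Released under Apache 2.0 license as described in the file LICENSE.
-/
import Summits.HodgeConjecture.HodgeConjecture.Theorems.K2E1BorelEisensteinUDefs               -- ★ `eisensteinSeriesU` (generic datum), `flatSectionU` (Mok's `U(J_N)`)
import Summits.HodgeConjecture.HodgeConjecture.Theorems.K2E1SphericalEisensteinL2ResidueCMTwo    -- ★ R5 at `χ = 1`: `residueValue_eq_const_cm_two_of_ms` (the spherical residue is the constant `φ₀ r`)
import Literature.NumberTheory.Automorphic.UnitaryGroupBorelTruncation                           -- ★ `pseudoEisenstein`, `borelConstantTerm`, `constantTermTail`, `truncation`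
import Literature.NumberTheory.Automorphic.AutomorphicTwist                                      -- ★ `AdelicGroupData.AutomorphicCharacter` (`map_of_mem`, `norm_coe`, `continuous`)
import Literature.NumberTheory.Automorphic.UnitaryGroupAdelicCharactersDetQuasiSplit             -- ★ `apply_eq_one_of_det_eq_one`: continuous characters of `U(Φ_N)(𝔸)`, `N ≥ 2`, kill `det = 1`
import Literature.NumberTheory.Automorphic.MahlerCriterionPrelims                                -- ★ `det_eq_one_of_mem_upperUnitriangular`
import HarnessLib

/-!
# THE `det`-TWIST OF THE BOREL EISENSTEIN FAMILIES OF `U(J)`: `E(f · Θ) = Θ · E(f)` for an automorphic character `Θ` (e.g. `Θ = ψ ∘ det`), for the raw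
series, the flat sections, the pseudo-Eisenstein sums, the constant terms, Arthur's truncation, the continued family and its residue at `z = 1`
(Rogawski 1990, §13.3 p. 202; Mœglin–Waldspurger 1995, II.1.5, IV.1.11)

Cell `pub/hodgecm-mathlib`, R90-TF section S8 «ContSpec-n½» (R90-CS-plan (g0) deal «p07a», ROAD memo `R90/S8/ROAD-S8B2.K2E1-p13-g3.md` §4 SECOND FRAGMENT,
R5 «residue identification» for a general character by TWIST from the ★ spherical theory).  THEOREMS ONLY (no `def`, no `instance`, no notation, no
named-fact hypothesis, no `sorry`); lane `--supports stmt-HodgeConjecture-24833 --as helper` (count-neutral, closes no socket).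

THE POINT.  Every object of the Borel–Eisenstein calculus of `G = U(J)` is built from left translates `x ↦ f(γ x)`, `γ ∈ G(F)`, or `x ↦ f(u x)`, `u ∈ N(𝔸)`.
A multiplier `Θ : G(𝔸) → ℂ` with `Θ(γ x) = Θ(x)` (`γ ∈ G(F)`) therefore passes through the Eisenstein series and the pseudo-Eisenstein sums, and one with
`Θ(u x) = Θ(x)` (`u ∈ N(𝔸)`) passes through the constant term; an AUTOMORPHIC CHARACTER (★ `AdelicGroupData.AutomorphicCharacter`: continuous, unitary,
trivial on `A_G · G(F)`) has the first property always (`G(F) ≤ A_G · G(F)`, ★ `arithmeticSubgroup_le_quotientSubgroup`) and, on Mok's quasi-split `U(Φ_N)`,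
`N ≥ 2`, ALSO the second: EVERY continuous character of `U(Φ_N)(𝔸)` kills the elements of determinant one (★ Literature
`UnitaryGroup.AdelicCharactersDetQuasiSplit.apply_eq_one_of_det_eq_one`, [GelbartRogawski1991, §3.1 Remark p. 457]) and unipotent elements have determinant one
(★ `Mahler.det_eq_one_of_mem_upperUnitriangular`) — §4 discharges the unipotent letter for every `Θ` (in particular for `Θ = cmDetChar L N Φ_N ψ hψ _ = ψ ∘ det`,
★ Literature `UnitaryGroupDetCharacter`).  Consequently the CONTINUED family `Ẽ(z)·Θ` carries every letter of the E1 continued-Eisenstein package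
(★ `K2E1ContinuedEisensteinResidueFunctionUTwo` / ★ `K2E1SphericalEisensteinL2ResidueCMTwo`: `hEd hE4 hEbd hEcinv hE2 hE3`, the pole letter `(Fp, hF, hFE)`), and its
residue at `z = 1` is `Θ` times the untwisted residue: for the spherical section `φ₀` this is Rogawski's «the residue of `E(φ₀ · (ψ∘det), z)` at the top pole is the
multiple `φ₀ r · (ψ ∘ det)` of the character» (§5, over ★ `residueValue_eq_const_cm_two_of_ms`).

CONTENTS («twist» always means the pointwise product `fun x => f x * Θ x`; `𝒢 = adelicGroupData F E c N J` in §1, Mok's `quasiSplit F E c N` from §2 on):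
* §1 `toAdelic_mem_quotientSubgroup`, `automorphicCharacter_toAdelic_mul`, **`eisensteinSeriesU_mul_of_forall_toAdelic_mul`**, **`eisensteinSeriesU_mul_automorphicCharacter`**
  (`E(f·Θ)(g) = E(f)(g)·Θ(g)`, NO convergence needed: Mathlib `tsum_mul_right` over `ℂ`), `summable_eisensteinTerm_mul_iff`.
* §2 `flatSectionU_mul`, **`eisensteinSeriesU_flatSectionU_mul_automorphicCharacter`**, `automorphicCharacter_arithmetic_mul`, **`pseudoEisenstein_mul_of_forall_arithmetic_mul`**,
  **`pseudoEisenstein_mul_automorphicCharacter`** (Mathlib `finsum_mul`, unconditional over `ℂ`), **`borelConstantTerm_mul_of_forall_unipotent_mul`**, `constantTermTail_mul_of_forall_unipotent_mul`,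
  **`truncation_mul_of_forall`** (`Λ^T(φ·Θ) = (Λ^T φ)·Θ`).
* §3 LETTER TRANSPORT for a continued family `Ec : ℂ → G(𝔸) → ℂ` (binder shapes VERBATIM from the ★ continued-Eisenstein files; any `N`):
  `differentiableOn_twist`, `continuous_twist`, `locally_bounded_twist`, `rational_invariant_twist`, `eq_eisensteinSeriesU_flatSectionU_twist`, `borelConstantTerm_twist`,
  `truncation_twist`, `pole_letter_twist` (`Fp ↦ fun g z => Fp g z * Θ g`), `residue_twist` (the residue VALUE of any pole letter of `Ẽ·Θ` is `Fp g 1 · Θ g`).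
* §4 `continuous_automorphicCharacter_toMonoidHom`, `det_coe_adelicUnipotent_eq_one`, **`automorphicCharacter_apply_adelicUnipotent`** (`Θ(u) = 1`, every `Θ`, `N ≥ 2`),
  `automorphicCharacter_adelicUnipotent_mul`; letter-free forms `borelConstantTerm_mul_automorphicCharacter`, `truncation_mul_automorphicCharacter`.
* §5 CM, `N = 2`: **`residue_detTwist_eq_const_mul_cm_two`** — ★ `residueValue_eq_const_cm_two_of_ms`'s binders VERBATIM minus its pole letter `(Fp, hF, hFE)`, plus
  `(Θ)` and ANY pole letter `(Fp', hF', hFE')` of the twisted family `z ↦ Ẽ(z)·Θ`: `∀ g, Fp' g 1 = φ₀ * r * Θ g`.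

NOT HERE: the Hilbert-90 step «a unitary character `χ` of `T(F)∖T(𝔸)` with `χ|_{𝔸_F^×} = 1` is `(ψ∘det)|_T`» (number theory, ★ Literature
`UnitaryGroupDetCharacterSection`) and the `K`-finite residue functional (ROAD §4, separate file).

HONEST LABEL: HC_CM is proved only modulo the 7 printed citations (2 remaining named inputs: hLiu418 = `stmt-HodgeConjecture-24832`, h413 =
`stmt-HodgeConjecture-24833`) until rung 0 closes; REL ≠ ★ ≠ BUILT; count-neutral helper, closes no socket.
-/

-- (for Claude) Library norms: see HarnessLib/Guide.lean. Problem-specific definitions are under review —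
-- flag anything that looks too strong or too weak.

set_option autoImplicit false
set_option linter.style.longLine false
set_option linter.dupNamespace false

noncomputable section

open MeasureTheory Measure NumberField IsDedekindDomain Set Filter Topology Metric MulAction
open scoped ENNReal NNReal MatrixGroups
open Literature.NumberTheory.Automorphic Literature.NumberTheory.Automorphic.UnitaryGroup AdelicGroupData
open Summit.HodgeConjecture.HodgeConjecture.Cruxes.H413.K2E1BorelEisensteinU
open Summit.HodgeConjecture.HodgeConjecture.Cruxes.H413.K2E1SphericalEisensteinL2ResidueCMTwo (residueValue_eq_const_cm_two_of_ms)

namespace Summit.HodgeConjecture.HodgeConjecture.Cruxes.H413.K2E1ChiEisensteinDetTwistU2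

/-! ## §1 The raw Eisenstein series of `U(J)` (generic datum `adelicGroupData F E c N J`) -/

section Generic

variable {F E : Type} [Field F] [NumberField F] [Field E] [NumberField E] [Algebra F E] {c : E ≃ₐ[F] E} {N : ℕ} {J : Matrix (Fin N) (Fin N) E}

/-- Rational points lie in `A_G · G(F)`: `toAdelic γ ∈ quotientSubgroup` (★ `arithmeticSubgroup = range toAdelic ≤ quotientSubgroup`). [folklore] -/
theorem toAdelic_mem_quotientSubgroup (γ : ↥(unitaryGroupOfForm (c : E →+* E) J)) :
    (adelicGroupData F E c N J).toAdelic γ ∈ (adelicGroupData F E c N J).quotientSubgroup :=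
  (adelicGroupData F E c N J).arithmeticSubgroup_le_quotientSubgroup ⟨γ, rfl⟩

/-- **An automorphic character is left-`G(F)`-invariant**: `Θ(γ x) = Θ(x)` for `γ ∈ G(F)` (`Θ(γ) = 1`). [cite: Rogawski1990, §13.3 p. 202] -/
theorem automorphicCharacter_toAdelic_mul (Θ : (adelicGroupData F E c N J).AutomorphicCharacter) (γ : ↥(unitaryGroupOfForm (c : E →+* E) J))
    (x : (adelicGroupData F E c N J).Adelic) :
    (((Θ ((adelicGroupData F E c N J).toAdelic γ * x) : ℂˣ) : ℂ)) = ((Θ x : ℂˣ) : ℂ) := by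
  rw [map_mul, Θ.map_of_mem (toAdelic_mem_quotientSubgroup γ), one_mul]

/-- **`E(f·θ)(g) = E(f)(g)·θ(g)` for every left-`G(F)`-invariant multiplier `θ`** — each term `f(γ̃_q g) θ(γ̃_q g) = f(γ̃_q g) θ(g)`, and `∑'` is `ℂ`-linear on the right with or
without convergence (Mathlib `tsum_mul_right`). [cite: MoeglinWaldspurger1995, II.1.5] [cite: Rogawski1990, §13.3 p. 202] -/
theorem eisensteinSeriesU_mul_of_forall_toAdelic_mul {f θ : (adelicGroupData F E c N J).Adelic → ℂ}
    (hθ : ∀ (γ : ↥(unitaryGroupOfForm (c : E →+* E) J)) (x : (adelicGroupData F E c N J).Adelic), θ ((adelicGroupData F E c N J).toAdelic γ * x) = θ x)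
    (g : (adelicGroupData F E c N J).Adelic) :
    eisensteinSeriesU (fun x => f x * θ x) g = eisensteinSeriesU f g * θ g := by
  simp only [eisensteinSeriesU_def, hθ]
  exact tsum_mul_right

/-- **`E(f·Θ)(g) = E(f)(g)·Θ(g)` for an automorphic character `Θ`** (e.g. `Θ = ψ∘det`). [cite: Rogawski1990, §13.3 p. 202] [cite: MoeglinWaldspurger1995, II.1.5] -/
theorem eisensteinSeriesU_mul_automorphicCharacter (Θ : (adelicGroupData F E c N J).AutomorphicCharacter) (f : (adelicGroupData F E c N J).Adelic → ℂ)
    (g : (adelicGroupData F E c N J).Adelic) :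
    eisensteinSeriesU (fun x => f x * ((Θ x : ℂˣ) : ℂ)) g = eisensteinSeriesU f g * ((Θ g : ℂˣ) : ℂ) :=
  eisensteinSeriesU_mul_of_forall_toAdelic_mul (fun γ x => automorphicCharacter_toAdelic_mul Θ γ x) g

/-- **The twist does not change the domain of convergence**: at `g` with `θ(g) ≠ 0` the series of `f·θ` converges iff that of `f` does. [cite: MoeglinWaldspurger1995, II.1.5] -/
theorem summable_eisensteinTerm_mul_iff {f θ : (adelicGroupData F E c N J).Adelic → ℂ}
    (hθ : ∀ (γ : ↥(unitaryGroupOfForm (c : E →+* E) J)) (x : (adelicGroupData F E c N J).Adelic), θ ((adelicGroupData F E c N J).toAdelic γ * x) = θ x)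
    {g : (adelicGroupData F E c N J).Adelic} (hg : θ g ≠ 0) :
    (Summable fun q : Quotient (orbitRel ↥(borelU (c : E →+* E) J) ↥(unitaryGroupOfForm (c : E →+* E) J)) =>
        (fun x => f x * θ x) ((adelicGroupData F E c N J).toAdelic (Quotient.out q : ↥(unitaryGroupOfForm (c : E →+* E) J)) * g)) ↔
      Summable fun q : Quotient (orbitRel ↥(borelU (c : E →+* E) J) ↥(unitaryGroupOfForm (c : E →+* E) J)) =>
        f ((adelicGroupData F E c N J).toAdelic (Quotient.out q : ↥(unitaryGroupOfForm (c : E →+* E) J)) * g) := by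
  simp only [hθ]
  exact summable_mul_right_iff hg

end Generic

/-! ## §2 Mok's `U(J_N)`: flat sections, pseudo-Eisenstein sums, constant terms, truncation -/

section QuasiSplit

variable {F E : Type} [Field F] [NumberField F] [Field E] [NumberField E] [Algebra F E] {c : E ≃ₐ[F] E} {N : ℕ}

/-- **`(φ·θ)·H^z = (φ·H^z)·θ`**: twisting commutes with forming flat sections. [cite: MoeglinWaldspurger1995, II.1.5] -/
theorem flatSectionU_mul [NeZero N] (φ θ : (quasiSplit F E c N).Adelic → ℂ) (z : ℂ) :
    flatSectionU (fun x => φ x * θ x) z = fun x => flatSectionU φ z x * θ x := by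
  funext x
  simp only [flatSectionU_apply]
  ring

/-- **`E(φ·Θ, z)(g) = E(φ, z)(g)·Θ(g)`** for the flat-section family and an automorphic character `Θ` — every `z`, every `g`, no convergence needed.
[cite: Rogawski1990, §13.3 p. 202] [cite: MoeglinWaldspurger1995, II.1.5] -/
theorem eisensteinSeriesU_flatSectionU_mul_automorphicCharacter [NeZero N] (Θ : (quasiSplit F E c N).AutomorphicCharacter)
    (φ : (quasiSplit F E c N).Adelic → ℂ) (z : ℂ) (g : (quasiSplit F E c N).Adelic) :
    eisensteinSeriesU (flatSectionU (fun x => φ x * ((Θ x : ℂˣ) : ℂ)) z) g = eisensteinSeriesU (flatSectionU φ z) g * ((Θ g : ℂˣ) : ℂ) := by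
  rw [flatSectionU_mul]
  exact eisensteinSeriesU_mul_automorphicCharacter Θ _ g

/-- An automorphic character is invariant under the arithmetic subgroup `G(F) ≤ G(𝔸)`: `Θ(γ x) = Θ(x)`. [cite: Rogawski1990, §13.3 p. 202] -/
theorem automorphicCharacter_arithmetic_mul (Θ : (quasiSplit F E c N).AutomorphicCharacter) (γ : (quasiSplit F E c N).arithmeticSubgroup)
    (x : (quasiSplit F E c N).Adelic) :
    ((Θ ((γ : (quasiSplit F E c N).Adelic) * x) : ℂˣ) : ℂ) = ((Θ x : ℂˣ) : ℂ) := by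
  rw [map_mul, Θ.map_of_mem ((quasiSplit F E c N).arithmeticSubgroup_le_quotientSubgroup γ.2), one_mul]

/-- **`Ψ_{ψ·θ}(g) = Ψ_ψ(g)·θ(g)`** for the pseudo-Eisenstein `finsum` and a left-`G(F)`-invariant multiplier (Mathlib `finsum_mul`, unconditional over `ℂ`: the supports of
the two families of terms agree when `θ(g) ≠ 0`, and both sides vanish when `θ(g) = 0`). [cite: Garrett2018, §2.10] [cite: MoeglinWaldspurger1995, II.1.10] -/
theorem pseudoEisenstein_mul_of_forall_arithmetic_mul {ψ θ : (quasiSplit F E c N).Adelic → ℂ}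
    (hθ : ∀ (γ : (quasiSplit F E c N).arithmeticSubgroup) (x : (quasiSplit F E c N).Adelic), θ ((γ : (quasiSplit F E c N).Adelic) * x) = θ x)
    (g : (quasiSplit F E c N).Adelic) :
    pseudoEisenstein (fun x => ψ x * θ x) g = pseudoEisenstein ψ g * θ g := by
  simp only [pseudoEisenstein_def, hθ]
  exact (finsum_mul _ _).symm

/-- **`Ψ_{ψ·Θ}(g) = Ψ_ψ(g)·Θ(g)`** for an automorphic character `Θ`. [cite: Garrett2018, §2.10] [cite: Rogawski1990, §13.3 p. 202] -/
theorem pseudoEisenstein_mul_automorphicCharacter (Θ : (quasiSplit F E c N).AutomorphicCharacter) (ψ : (quasiSplit F E c N).Adelic → ℂ)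
    (g : (quasiSplit F E c N).Adelic) :
    pseudoEisenstein (fun x => ψ x * ((Θ x : ℂˣ) : ℂ)) g = pseudoEisenstein ψ g * ((Θ g : ℂˣ) : ℂ) :=
  pseudoEisenstein_mul_of_forall_arithmetic_mul (fun γ x => automorphicCharacter_arithmetic_mul Θ γ x) g

variable [MeasurableSpace ↥(adelicUnipotent F E c N)]

/-- **`(φ·θ)_B(g) = φ_B(g)·θ(g)`** for a multiplier invariant under `N(𝔸)` (`θ(u x) = θ(x)`): the Borel constant term is an `N(𝔸)`-average of left translates.
[cite: Rogawski1990, §2.1] [cite: MoeglinWaldspurger1995, I.2.6] -/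
theorem borelConstantTerm_mul_of_forall_unipotent_mul (ν : Measure ↥(adelicUnipotent F E c N)) (𝓕 : Set ↥(adelicUnipotent F E c N))
    {φ θ : (quasiSplit F E c N).Adelic → ℂ} (hθ : ∀ (u : ↥(adelicUnipotent F E c N)) (x : (quasiSplit F E c N).Adelic), θ ((u : (quasiSplit F E c N).Adelic) * x) = θ x)
    (g : (quasiSplit F E c N).Adelic) :
    borelConstantTerm ν 𝓕 (fun x => φ x * θ x) g = borelConstantTerm ν 𝓕 φ g * θ g := by
  simp only [borelConstantTerm_def, hθ]
  rw [integral_mul_const, smul_mul_assoc]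

/-- The tail `𝟙[T < H]·φ_B` of the twisted function is the twisted tail. [cite: Garrett2018, §2.10] -/
theorem constantTermTail_mul_of_forall_unipotent_mul [NeZero N] (ν : Measure ↥(adelicUnipotent F E c N)) (𝓕 : Set ↥(adelicUnipotent F E c N)) (T : ℝ≥0)
    {φ θ : (quasiSplit F E c N).Adelic → ℂ} (hθ : ∀ (u : ↥(adelicUnipotent F E c N)) (x : (quasiSplit F E c N).Adelic), θ ((u : (quasiSplit F E c N).Adelic) * x) = θ x) :
    constantTermTail ν 𝓕 T (fun x => φ x * θ x) = fun x => constantTermTail ν 𝓕 T φ x * θ x := by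
  funext x
  by_cases hx : T < borelHeight x
  · rw [constantTermTail_of_lt _ hx, constantTermTail_of_lt _ hx, borelConstantTerm_mul_of_forall_unipotent_mul ν 𝓕 hθ]
  · rw [constantTermTail_of_not_lt _ hx, constantTermTail_of_not_lt _ hx, zero_mul]

/-- **`Λ^T(φ·θ) = (Λ^T φ)·θ`**: Arthur's truncation commutes with a multiplier that is left-`G(F)`-invariant and `N(𝔸)`-invariant.
[cite: MoeglinWaldspurger1995, I.2.13] [cite: Garrett2018, §2.10] -/
theorem truncation_mul_of_forall [NeZero N] (ν : Measure ↥(adelicUnipotent F E c N)) (𝓕 : Set ↥(adelicUnipotent F E c N)) (T : ℝ≥0)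
    {φ θ : (quasiSplit F E c N).Adelic → ℂ}
    (hθΓ : ∀ (γ : (quasiSplit F E c N).arithmeticSubgroup) (x : (quasiSplit F E c N).Adelic), θ ((γ : (quasiSplit F E c N).Adelic) * x) = θ x)
    (hθN : ∀ (u : ↥(adelicUnipotent F E c N)) (x : (quasiSplit F E c N).Adelic), θ ((u : (quasiSplit F E c N).Adelic) * x) = θ x)
    (g : (quasiSplit F E c N).Adelic) :
    truncation ν 𝓕 T (fun x => φ x * θ x) g = truncation ν 𝓕 T φ g * θ g := by
  rw [truncation_def, truncation_def, constantTermTail_mul_of_forall_unipotent_mul ν 𝓕 T hθN, pseudoEisenstein_mul_of_forall_arithmetic_mul hθΓ, sub_mul]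

end QuasiSplit

/-! ## §3 Letter transport for a continued family `Ẽ : ℂ → G(𝔸) → ℂ` (binder shapes of the ★ continued-Eisenstein package) -/

section Letters

variable {F E : Type} [Field F] [NumberField F] [Field E] [NumberField E] [Algebra F E] {c : E ≃ₐ[F] E} {N : ℕ}

/-- (E1) holomorphy in `z` passes to the twist (constant factor `Θ(g)`). [cite: MoeglinWaldspurger1995, IV.1.11] -/
theorem differentiableOn_twist (Ec : ℂ → (quasiSplit F E c N).Adelic → ℂ) {D : Set ℂ} (hEd : ∀ g, DifferentiableOn ℂ (fun z => Ec z g) D)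
    (θ : (quasiSplit F E c N).Adelic → ℂ) : ∀ g, DifferentiableOn ℂ (fun z => Ec z g * θ g) D :=
  fun g => (hEd g).mul_const _

/-- (E4) continuity in `g` passes to the twist by an automorphic character. [cite: MoeglinWaldspurger1995, IV.1.11] -/
theorem continuous_twist (Ec : ℂ → (quasiSplit F E c N).Adelic → ℂ) {D : Set ℂ} (hE4 : ∀ z ∈ D, Continuous (Ec z))
    (Θ : (quasiSplit F E c N).AutomorphicCharacter) : ∀ z ∈ D, Continuous fun x => Ec z x * ((Θ x : ℂˣ) : ℂ) :=
  fun z hz => (hE4 z hz).mul Θ.continuous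

/-- (E2-bd) local compact-uniform bounds pass to the twist (`‖Θ‖ = 1`). [cite: MoeglinWaldspurger1995, IV.1.11] -/
theorem locally_bounded_twist (Ec : ℂ → (quasiSplit F E c N).Adelic → ℂ) {D : Set ℂ}
    (hEbd : ∀ z₀ ∈ D, ∀ K : Set (quasiSplit F E c N).Adelic, IsCompact K → ∃ V ∈ 𝓝 z₀, ∃ M : ℝ, ∀ z ∈ V, ∀ g ∈ K, ‖Ec z g‖ ≤ M)
    (Θ : (quasiSplit F E c N).AutomorphicCharacter) :
    ∀ z₀ ∈ D, ∀ K : Set (quasiSplit F E c N).Adelic, IsCompact K → ∃ V ∈ 𝓝 z₀, ∃ M : ℝ, ∀ z ∈ V, ∀ g ∈ K, ‖Ec z g * ((Θ g : ℂˣ) : ℂ)‖ ≤ M := by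
  intro z₀ hz₀ K hK
  obtain ⟨V, hV, M, hM⟩ := hEbd z₀ hz₀ K hK
  refine ⟨V, hV, M, fun z hz g hg => ?_⟩
  rw [norm_mul, Θ.norm_coe, mul_one]
  exact hM z hz g hg

/-- Left-`G(F)`-invariance passes to the twist by an automorphic character. [cite: MoeglinWaldspurger1995, IV.1.11] [cite: Rogawski1990, §13.3 p. 202] -/
theorem rational_invariant_twist (Ec : ℂ → (quasiSplit F E c N).Adelic → ℂ) {D : Set ℂ}
    (hEcinv : ∀ z ∈ D, ∀ (γ : (quasiSplit F E c N).arithmeticSubgroup) (x : (quasiSplit F E c N).Adelic), Ec z ((γ : (quasiSplit F E c N).Adelic) * x) = Ec z x)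
    (Θ : (quasiSplit F E c N).AutomorphicCharacter) :
    ∀ z ∈ D, ∀ (γ : (quasiSplit F E c N).arithmeticSubgroup) (x : (quasiSplit F E c N).Adelic),
      Ec z ((γ : (quasiSplit F E c N).Adelic) * x) * ((Θ ((γ : (quasiSplit F E c N).Adelic) * x) : ℂˣ) : ℂ) = Ec z x * ((Θ x : ℂˣ) : ℂ) :=
  fun z hz γ x => by rw [hEcinv z hz γ x, automorphicCharacter_arithmetic_mul]

/-- (E2) «`Ẽ(z) = E(φ, z)` on the half-plane of convergence» passes to the twist: `Ẽ(z)·Θ = E(φ·Θ, z)` there (§2). [cite: MoeglinWaldspurger1995, II.1.5, IV.1.8] -/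
theorem eq_eisensteinSeriesU_flatSectionU_twist [NeZero N] (Ec : ℂ → (quasiSplit F E c N).Adelic → ℂ) {D : Set ℂ} {σ₁ : ℝ}
    {φ : (quasiSplit F E c N).Adelic → ℂ} (hE2 : ∀ z ∈ D, σ₁ < z.re → Ec z = eisensteinSeriesU (flatSectionU φ z))
    (Θ : (quasiSplit F E c N).AutomorphicCharacter) :
    ∀ z ∈ D, σ₁ < z.re → (fun x => Ec z x * ((Θ x : ℂˣ) : ℂ)) = eisensteinSeriesU (flatSectionU (fun x => φ x * ((Θ x : ℂˣ) : ℂ)) z) := by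
  intro z hz hre
  funext x
  rw [hE2 z hz hre, eisensteinSeriesU_flatSectionU_mul_automorphicCharacter]

/-- (E3) the constant-term letter passes to the twist, picking up the factor `Θ(g)`, for a multiplier invariant under `N(𝔸)` (§4 supplies this for every automorphic
character of `U(Φ_N)`, `N ≥ 2`). [cite: MoeglinWaldspurger1995, II.1.7, IV.1.9] -/
theorem borelConstantTerm_twist [NeZero N] [MeasurableSpace ↥(adelicUnipotent F E c N)] (ν : Measure ↥(adelicUnipotent F E c N)) (𝓕 : Set ↥(adelicUnipotent F E c N))
    (Ec : ℂ → (quasiSplit F E c N).Adelic → ℂ) {D : Set ℂ} {φ₀ : ℂ} {cc : ℂ → ℂ}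
    (hE3 : ∀ z ∈ D, ∀ g : (quasiSplit F E c N).Adelic,
      borelConstantTerm ν 𝓕 (Ec z) g = φ₀ * ((((borelHeight g : ℝ≥0) : ℝ) : ℂ) ^ z + cc z * (((borelHeight g : ℝ≥0) : ℝ) : ℂ) ^ (1 - z)))
    {θ : (quasiSplit F E c N).Adelic → ℂ} (hθ : ∀ (u : ↥(adelicUnipotent F E c N)) (x : (quasiSplit F E c N).Adelic), θ ((u : (quasiSplit F E c N).Adelic) * x) = θ x) :
    ∀ z ∈ D, ∀ g : (quasiSplit F E c N).Adelic,
      borelConstantTerm ν 𝓕 (fun x => Ec z x * θ x) g = φ₀ * ((((borelHeight g : ℝ≥0) : ℝ) : ℂ) ^ z + cc z * (((borelHeight g : ℝ≥0) : ℝ) : ℂ) ^ (1 - z)) * θ g := by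
  intro z hz g
  rw [borelConstantTerm_mul_of_forall_unipotent_mul ν 𝓕 hθ, hE3 z hz g]

/-- The truncation letter passes to the twist: `Λ^T(Ẽ(z)·θ) = (Λ^T Ẽ(z))·θ` (§2 `truncation_mul_of_forall`). [cite: MoeglinWaldspurger1995, I.2.13, IV.2] -/
theorem truncation_twist [NeZero N] [MeasurableSpace ↥(adelicUnipotent F E c N)] (ν : Measure ↥(adelicUnipotent F E c N)) (𝓕 : Set ↥(adelicUnipotent F E c N))
    (T : ℝ≥0) (Ec : ℂ → (quasiSplit F E c N).Adelic → ℂ) {θ : (quasiSplit F E c N).Adelic → ℂ}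
    (hθΓ : ∀ (γ : (quasiSplit F E c N).arithmeticSubgroup) (x : (quasiSplit F E c N).Adelic), θ ((γ : (quasiSplit F E c N).Adelic) * x) = θ x)
    (hθN : ∀ (u : ↥(adelicUnipotent F E c N)) (x : (quasiSplit F E c N).Adelic), θ ((u : (quasiSplit F E c N).Adelic) * x) = θ x) (z : ℂ) :
    truncation ν 𝓕 T (fun x => Ec z x * θ x) = fun g => truncation ν 𝓕 T (Ec z) g * θ g :=
  funext fun g => truncation_mul_of_forall ν 𝓕 T hθΓ hθN g

/-- (F) THE POLE LETTER passes to the twist: if `Fp g` is analytic at `1` and agrees with `(z−1)Ẽ(z)(g)` on a punctured neighbourhood, then `z ↦ Fp g z · θ(g)` does the same for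
`Ẽ·θ`. [cite: MoeglinWaldspurger1995, IV.1.11] -/
theorem pole_letter_twist (Ec : ℂ → (quasiSplit F E c N).Adelic → ℂ) (Fp : (quasiSplit F E c N).Adelic → ℂ → ℂ) (hF : ∀ g, AnalyticAt ℂ (Fp g) 1)
    (hFE : ∀ g, Fp g =ᶠ[𝓝[≠] 1] fun z => (z - 1) * Ec z g) (θ : (quasiSplit F E c N).Adelic → ℂ) :
    (∀ g, AnalyticAt ℂ (fun z => Fp g z * θ g) 1) ∧ ∀ g, (fun z => Fp g z * θ g) =ᶠ[𝓝[≠] 1] fun z => (z - 1) * (Ec z g * θ g) := by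
  refine ⟨fun g => (hF g).mul analyticAt_const, fun g => ?_⟩
  filter_upwards [hFE g] with z hz
  rw [hz, mul_assoc]

/-- **THE RESIDUE VALUE OF THE TWIST IS THE TWISTED RESIDUE VALUE**: for ANY pole letter `(Fp', hF', hFE')` of `Ẽ·θ` and any pole letter `(Fp, hF, hFE)` of `Ẽ`,
`Fp' g 1 = Fp g 1 · θ(g)` (limits along `𝓝[≠] 1` are unique). [cite: MoeglinWaldspurger1995, IV.1.11] -/
theorem residue_twist (Ec : ℂ → (quasiSplit F E c N).Adelic → ℂ) (Fp : (quasiSplit F E c N).Adelic → ℂ → ℂ) (hF : ∀ g, AnalyticAt ℂ (Fp g) 1)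
    (hFE : ∀ g, Fp g =ᶠ[𝓝[≠] 1] fun z => (z - 1) * Ec z g) (θ : (quasiSplit F E c N).Adelic → ℂ)
    (Fp' : (quasiSplit F E c N).Adelic → ℂ → ℂ) (hF' : ∀ g, AnalyticAt ℂ (Fp' g) 1) (hFE' : ∀ g, Fp' g =ᶠ[𝓝[≠] 1] fun z => (z - 1) * (Ec z g * θ g))
    (g : (quasiSplit F E c N).Adelic) : Fp' g 1 = Fp g 1 * θ g := by
  have h1 : Tendsto (Fp' g) (𝓝[≠] 1) (𝓝 (Fp' g 1)) := tendsto_nhdsWithin_of_tendsto_nhds (hF' g).continuousAt.tendsto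
  have h2 : Tendsto (fun z => Fp g z * θ g) (𝓝[≠] 1) (𝓝 (Fp g 1 * θ g)) :=
    (tendsto_nhdsWithin_of_tendsto_nhds (hF g).continuousAt.tendsto).mul_const _
  have heq : Fp' g =ᶠ[𝓝[≠] 1] fun z => Fp g z * θ g := by
    filter_upwards [hFE' g, hFE g] with z hz hz'
    rw [hz, hz', mul_assoc]
  exact tendsto_nhds_unique (h1.congr' heq) h2

end Letters

/-! ## §4 Every automorphic character of `U(Φ_N)(𝔸)`, `N ≥ 2`, kills `N(𝔸)` — the unipotent letter discharged -/

section Unipotent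

variable (L : Type) [Field L] [NumberField L] [IsCMField L] {N : ℕ}

/-- An automorphic character is continuous as a map into `ℂˣ` (its values are non-zero complex numbers depending continuously on `g`). [folklore] -/
theorem continuous_automorphicCharacter_toMonoidHom
    (Θ : (quasiSplit (↥(maximalRealSubfield L)) L (IsCMField.complexConj L) N).AutomorphicCharacter) : Continuous Θ.toMonoidHom := by
  refine Units.continuous_iff.2 ⟨Θ.continuous, ?_⟩
  simp only [Units.val_inv_eq_inv_val]
  exact Θ.continuous.inv₀ fun g => (Θ g).ne_zero

/-- Unipotent adelic points of `U(Φ_N)` have determinant one. [folklore] -/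
theorem det_coe_adelicUnipotent_eq_one (u : ↥(adelicUnipotent (↥(maximalRealSubfield L)) L (IsCMField.complexConj L) N)) :
    (((adelicVal (↥(maximalRealSubfield L)) L (IsCMField.complexConj L) N _ (u : (quasiSplit (↥(maximalRealSubfield L)) L (IsCMField.complexConj L) N).Adelic) :
      GL (Fin N) (AdeleRing (𝓞 L) L)) : Matrix (Fin N) (Fin N) (AdeleRing (𝓞 L) L))).det = 1 := by
  have h := Mahler.det_eq_one_of_mem_upperUnitriangular ((mem_adelicUnipotent_iff _).1 u.2)
  have h' := congrArg (fun w : (AdeleRing (𝓞 L) L)ˣ => (w : AdeleRing (𝓞 L) L)) h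
  simpa only [Matrix.GeneralLinearGroup.val_det_apply, Units.val_one] using h'

/-- **`Θ(u) = 1` for every automorphic character `Θ` of `U(Φ_N)(𝔸_{L⁺})`, `N ≥ 2`, and every `u ∈ N(𝔸)`** — continuous characters of the quasi-split unitary group kill the
elements of determinant one ([GelbartRogawski1991, §3.1 Remark], ★ Literature `apply_eq_one_of_det_eq_one`), and `det u = 1`. [cite: GelbartRogawski1991, §3.1 Remark p. 457] -/
theorem automorphicCharacter_apply_adelicUnipotent (hN : 2 ≤ N)
    (Θ : (quasiSplit (↥(maximalRealSubfield L)) L (IsCMField.complexConj L) N).AutomorphicCharacter)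
    (u : ↥(adelicUnipotent (↥(maximalRealSubfield L)) L (IsCMField.complexConj L) N)) :
    Θ (u : (quasiSplit (↥(maximalRealSubfield L)) L (IsCMField.complexConj L) N).Adelic) = 1 :=
  AdelicCharactersDetQuasiSplit.apply_eq_one_of_det_eq_one L hN Θ.toMonoidHom (continuous_automorphicCharacter_toMonoidHom L Θ) _
    (det_coe_adelicUnipotent_eq_one L u)

/-- **`Θ(u x) = Θ(x)`** for `u ∈ N(𝔸)`, every automorphic character `Θ` of `U(Φ_N)(𝔸)`, `N ≥ 2`. [cite: GelbartRogawski1991, §3.1 Remark p. 457] -/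
theorem automorphicCharacter_adelicUnipotent_mul (hN : 2 ≤ N)
    (Θ : (quasiSplit (↥(maximalRealSubfield L)) L (IsCMField.complexConj L) N).AutomorphicCharacter)
    (u : ↥(adelicUnipotent (↥(maximalRealSubfield L)) L (IsCMField.complexConj L) N)) (x : (quasiSplit (↥(maximalRealSubfield L)) L (IsCMField.complexConj L) N).Adelic) :
    ((Θ ((u : (quasiSplit (↥(maximalRealSubfield L)) L (IsCMField.complexConj L) N).Adelic) * x) : ℂˣ) : ℂ) = ((Θ x : ℂˣ) : ℂ) := by
  rw [map_mul, automorphicCharacter_apply_adelicUnipotent L hN Θ u, one_mul]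

variable [MeasurableSpace ↥(adelicUnipotent (↥(maximalRealSubfield L)) L (IsCMField.complexConj L) N)]

/-- **`(φ·Θ)_B = φ_B·Θ`, LETTER-FREE** for every automorphic character of `U(Φ_N)(𝔸)`, `N ≥ 2`. [cite: Rogawski1990, §2.1, §13.3 p. 202] -/
theorem borelConstantTerm_mul_automorphicCharacter (hN : 2 ≤ N)
    (ν : Measure ↥(adelicUnipotent (↥(maximalRealSubfield L)) L (IsCMField.complexConj L) N)) (𝓕 : Set ↥(adelicUnipotent (↥(maximalRealSubfield L)) L (IsCMField.complexConj L) N))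
    (Θ : (quasiSplit (↥(maximalRealSubfield L)) L (IsCMField.complexConj L) N).AutomorphicCharacter)
    (φ : (quasiSplit (↥(maximalRealSubfield L)) L (IsCMField.complexConj L) N).Adelic → ℂ) (g : (quasiSplit (↥(maximalRealSubfield L)) L (IsCMField.complexConj L) N).Adelic) :
    borelConstantTerm ν 𝓕 (fun x => φ x * ((Θ x : ℂˣ) : ℂ)) g = borelConstantTerm ν 𝓕 φ g * ((Θ g : ℂˣ) : ℂ) :=
  borelConstantTerm_mul_of_forall_unipotent_mul ν 𝓕 (automorphicCharacter_adelicUnipotent_mul L hN Θ) g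

/-- **`Λ^T(φ·Θ) = (Λ^T φ)·Θ`, LETTER-FREE** for every automorphic character of `U(Φ_N)(𝔸)`, `N ≥ 2`. [cite: MoeglinWaldspurger1995, I.2.13] [cite: Rogawski1990, §13.3 p. 202] -/
theorem truncation_mul_automorphicCharacter [NeZero N] (hN : 2 ≤ N)
    (ν : Measure ↥(adelicUnipotent (↥(maximalRealSubfield L)) L (IsCMField.complexConj L) N)) (𝓕 : Set ↥(adelicUnipotent (↥(maximalRealSubfield L)) L (IsCMField.complexConj L) N))
    (T : ℝ≥0) (Θ : (quasiSplit (↥(maximalRealSubfield L)) L (IsCMField.complexConj L) N).AutomorphicCharacter)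
    (φ : (quasiSplit (↥(maximalRealSubfield L)) L (IsCMField.complexConj L) N).Adelic → ℂ) (g : (quasiSplit (↥(maximalRealSubfield L)) L (IsCMField.complexConj L) N).Adelic) :
    truncation ν 𝓕 T (fun x => φ x * ((Θ x : ℂˣ) : ℂ)) g = truncation ν 𝓕 T φ g * ((Θ g : ℂˣ) : ℂ) :=
  truncation_mul_of_forall ν 𝓕 T (automorphicCharacter_arithmetic_mul Θ) (automorphicCharacter_adelicUnipotent_mul L hN Θ) g

end Unipotent

/-! ## §5 CM, `N = 2`: the residue of the `det`-twisted spherical family at `z = 1` is `φ₀ r · Θ` -/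

section CM

variable (L : Type) [Field L] [NumberField L] [IsCMField L]
variable [MeasurableSpace (quasiSplit (↥(maximalRealSubfield L)) L (IsCMField.complexConj L) 2).Adelic] [BorelSpace (quasiSplit (↥(maximalRealSubfield L)) L (IsCMField.complexConj L) 2).Adelic]

-- the statement carries ★ `residueValue_eq_const_cm_two_of_ms`'s letter package verbatim (≈ 3 kB of binders); same class as the ★ template
/-- **R5 FOR A `det`-TWISTED SPHERICAL SECTION ON `U(Φ₂)`: `Res_{z=1} E(φ₀·Θ, z)(g) = φ₀ r · Θ(g)`.**  Binders = ★ `residueValue_eq_const_cm_two_of_ms`'s VERBATIM (the continued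
spherical family `Ẽ` with its letters (E1)–(E4), (E2-bd), `G(F)`-invariance, the constant-term shape `φ₀(H^z + c(z)H^{1−z})` with `(z−1)c(z) → r`, the truncated `L²` family and
the Maass–Selberg bound (MS-1)) MINUS its pole letter `(Fp, hF, hFE)`, PLUS an automorphic character `Θ` of `U(Φ₂)(𝔸)` and ANY pole letter `(Fp', hF', hFE')` of the TWISTED
family `z ↦ Ẽ(z)·Θ` — which by §3 `eq_eisensteinSeriesU_flatSectionU_twist` IS the continued Eisenstein family of the twisted section `φ₀·Θ`, with every letter of the package
(§3, §4).  Proof: untwist the pole letter (`Θ(g) ≠ 0`), apply ★ R5 at `χ = 1`, re-twist (`residue_twist`). [cite: Rogawski1990, §13.3 p. 202] [cite: MoeglinWaldspurger1995, IV.1.11]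
[cite: Langlands1976, §7] -/
theorem residue_detTwist_eq_const_mul_cm_two
    (μ : Measure (quasiSplit (↥(maximalRealSubfield L)) L (IsCMField.complexConj L) 2).automorphicQuotient) [(quasiSplit (↥(maximalRealSubfield L)) L (IsCMField.complexConj L) 2).IsAutomorphicMeasure μ]
    (ν : Measure ↥(adelicUnipotent (↥(maximalRealSubfield L)) L (IsCMField.complexConj L) 2)) [ν.IsHaarMeasure]
    {𝓕 : Set ↥(adelicUnipotent (↥(maximalRealSubfield L)) L (IsCMField.complexConj L) 2)}
    (h𝓕N : IsFundamentalDomain ↥(rationalUnipotent (↥(maximalRealSubfield L)) L (IsCMField.complexConj L) 2) 𝓕 ν) (h𝓕c : IsCompact (closure 𝓕))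
    (φ₀ : ℂ) {T : ℝ≥0} (hT : 1 ≤ T)
    (Ec : ℂ → (quasiSplit (↥(maximalRealSubfield L)) L (IsCMField.complexConj L) 2).Adelic → ℂ) {D : Set ℂ} (hDo : IsOpen D) (hDc : IsPreconnected D)
    {σ₀ : ℝ} (hσ₀ : 1 < σ₀) (hσD : ∀ᶠ z in 𝓝 ((σ₀ : ℝ) : ℂ), z ∈ D) {ρ : ℝ} (hρ : 0 < ρ) (hρD : ∀ z : ℂ, z ≠ 1 → dist z 1 < ρ → z ∈ D)
    (hEd : ∀ g, DifferentiableOn ℂ (fun z => Ec z g) D) (hE4 : ∀ z ∈ D, Continuous (Ec z))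
    (hEbd : ∀ z₀ ∈ D, ∀ K : Set (quasiSplit (↥(maximalRealSubfield L)) L (IsCMField.complexConj L) 2).Adelic, IsCompact K → ∃ V ∈ 𝓝 z₀, ∃ M : ℝ, ∀ z ∈ V, ∀ g ∈ K, ‖Ec z g‖ ≤ M)
    (hEcinv : ∀ z ∈ D, ∀ (γ : (quasiSplit (↥(maximalRealSubfield L)) L (IsCMField.complexConj L) 2).arithmeticSubgroup) (x : (quasiSplit (↥(maximalRealSubfield L)) L (IsCMField.complexConj L) 2).Adelic),
      Ec z ((γ : (quasiSplit (↥(maximalRealSubfield L)) L (IsCMField.complexConj L) 2).Adelic) * x) = Ec z x)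
    (hE2 : ∀ z ∈ D, 1 < z.re → Ec z = eisensteinSeriesU (flatSectionU (fun _ : (quasiSplit (↥(maximalRealSubfield L)) L (IsCMField.complexConj L) 2).Adelic => φ₀) z))
    {cc : ℂ → ℂ} {r : ℂ} (hcres : Tendsto (fun z : ℂ => (z - 1) * cc z) (𝓝[≠] 1) (𝓝 r))
    (hE3 : ∀ z ∈ D, ∀ g : (quasiSplit (↥(maximalRealSubfield L)) L (IsCMField.complexConj L) 2).Adelic,
      borelConstantTerm ν 𝓕 (Ec z) g = φ₀ * ((((borelHeight g : ℝ≥0) : ℝ) : ℂ) ^ z + cc z * (((borelHeight g : ℝ≥0) : ℝ) : ℂ) ^ (1 - z)))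
    (Fam : ℂ → (quasiSplit (↥(maximalRealSubfield L)) L (IsCMField.complexConj L) 2).L2 μ) (hFd : DifferentiableOn ℂ Fam D)
    (hFam : ∀ z ∈ D, ((Fam z : (quasiSplit (↥(maximalRealSubfield L)) L (IsCMField.complexConj L) 2).L2 μ) : (quasiSplit (↥(maximalRealSubfield L)) L (IsCMField.complexConj L) 2).automorphicQuotient → ℂ) =ᵐ[μ]
      (quasiSplit (↥(maximalRealSubfield L)) L (IsCMField.complexConj L) 2).quotFun (truncation ν 𝓕 T (Ec z)))
    (hMS1 : ∃ C : ℝ, ∀ᶠ z in 𝓝[≠] (1 : ℂ), ‖(z - 1) • Fam z‖ ≤ C)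
    (Θ : (quasiSplit (↥(maximalRealSubfield L)) L (IsCMField.complexConj L) 2).AutomorphicCharacter)
    (Fp' : (quasiSplit (↥(maximalRealSubfield L)) L (IsCMField.complexConj L) 2).Adelic → ℂ → ℂ) (hF' : ∀ g, AnalyticAt ℂ (Fp' g) 1)
    (hFE' : ∀ g, Fp' g =ᶠ[𝓝[≠] 1] fun z => (z - 1) * (Ec z g * ((Θ g : ℂˣ) : ℂ))) :
    ∀ g : (quasiSplit (↥(maximalRealSubfield L)) L (IsCMField.complexConj L) 2).Adelic, Fp' g 1 = φ₀ * r * ((Θ g : ℂˣ) : ℂ) := by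
  -- untwist the pole letter: `Fp g z := Fp' g z · Θ(g)⁻¹` is a pole letter for `Ẽ`
  have hΘ0 : ∀ g : (quasiSplit (↥(maximalRealSubfield L)) L (IsCMField.complexConj L) 2).Adelic, ((Θ g : ℂˣ) : ℂ) ≠ 0 := fun g => (Θ g).ne_zero
  have hpole := pole_letter_twist (fun z g => Ec z g * ((Θ g : ℂˣ) : ℂ)) Fp' hF' hFE' (fun g => (((Θ g : ℂˣ) : ℂ))⁻¹)
  have hFE : ∀ g, (fun z => Fp' g z * (((Θ g : ℂˣ) : ℂ))⁻¹) =ᶠ[𝓝[≠] 1] fun z => (z - 1) * Ec z g := fun g => by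
    filter_upwards [hpole.2 g] with z hz
    rw [hz, mul_assoc, mul_inv_cancel₀ (hΘ0 g), mul_one]
  have hsph := residueValue_eq_const_cm_two_of_ms L μ ν h𝓕N h𝓕c φ₀ hT Ec hDo hDc hσ₀ hσD hρ hρD hEd hE4 hEbd hEcinv hE2 hcres hE3
    (fun g z => Fp' g z * (((Θ g : ℂˣ) : ℂ))⁻¹) hpole.1 hFE Fam hFd hFam hMS1
  intro g
  rw [← hsph g, mul_assoc, inv_mul_cancel₀ (hΘ0 g), mul_one]

end CM

end Summit.HodgeConjecture.HodgeConjecture.Cruxes.H413.K2E1ChiEisensteinDetTwistU2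

end
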